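import Mathlib.RingTheory.Polynomial.Chebyshev
import Mathlib.Analysis.SpecialFunctions.Trigonometric.Chebyshev.RootsExtrema
import Mathlib.Analysis.InnerProductSpace.Spectrum
import Mathlib.LinearAlgebra.Eigenspace.Minpoly
import HarnessLib

/-!
# Venture YMGap, track Y3 FLOW-DATA — stability of the perturbed three-term Chebyshev recurrence
# (lineage C «x2r» certificate, step R1: the ROUNDING half of the budget `e_g`)

HONEST FRAMING: venture file of the cell `pub-ymgap` (QuantumFields programme), track Y3, lineage C (engine-3; kernel «x2r»,
method note `engine/sce/results-Y3/onesite2/code-x2r/X2R-METHOD.md` § «The untruncated plaquette operator applied to a vector»,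
bookkeeping `engine/sce/CERT-CHAIN-C.md` step R1).  Pure linear algebra / elementary analysis; NO lattice, NO transfer matrix, no
number of record, nothing about limits or a mass gap.  The IEEE-754 (binary128) model that produces the per-step local errors `e_k`
is NOT formalised here — it stays the engine's hypothesis; this file types what the kernel's budget does WITH those local errors.

The x2r kernel evaluates `g = p_K(Y) φ = Σ_{k ≤ K} c_k T_k(Y) φ` (`Y` = the symmetric plaquette-variable operator `s = 1 − 2y` on the
light-cone box, spectrum in `[−1, 1]`; `c_k` = Chebyshev–Bessel coefficients) by the forward recurrence `t₀ = φ`, `t₁ = Y φ`,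
`t_{k+2} = 2 Y t_{k+1} − t_k`, each step committed with a local rounding error: `s₁ = Y φ + e₁`, `s_{k+2} = 2 Y s_{k+1} − s_k + e_{k+2}`.
Everything is stated for ARBITRARY sequences `t`, `s` satisfying these relations (no new definitions).  This file proves:

* `eq_aeval_T_of_rec` — the exact recurrence computes `T_k(Y) φ`;
* ★ `sub_eq_sum_U_of_rec` — the propagated error is `s_k − t_k = Σ_{j<k} U_{k−1−j}(Y) e_{j+1}` (second-kind Chebyshev polynomials
  `U_m` as growth factors), over any commutative ring / module;
* `norm_aeval_U_le` — if every `T_m(Y)` is a contraction then `‖U_m(Y) v‖ ≤ (m+1)‖v‖`, whence ★ `norm_sub_le_of_rec`: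
  `‖s_k − t_k‖ ≤ Σ_{j<k} (k − j)‖e_{j+1}‖ ≤ ε·k(k+1)/2` for uniformly bounded local errors, and ★ `norm_chebSum_sub_le`:
  `‖Σ_{k≤K} c_k s_k − Σ_{k≤K} c_k t_k‖ ≤ ε · Σ_{k≤K} |c_k| · k(k+1)/2` — the «second-kind growth factor» term of the method note's `δ_q`;
* `norm_aeval_T_le_of_isSymmetric` — the contraction hypothesis DISCHARGED for a symmetric `Y` with `‖Y v‖ ≤ ‖v‖` on a
  finite-dimensional real inner-product space (eigenbasis + `|T_m(λ)| ≤ 1` on `[−1,1]`, Mathlib `abs_eval_T_real_le_one`), and the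
  assembled statement ★ `norm_chebSum_sub_le_of_isSymmetric`.

References: NIST DLMF §3.11(ii) (summation of Chebyshev series by three-term recurrence) [cite: DLMF, 3.11(ii)] and 18.9.10
(`T_n = ½(U_n − U_{n−2})`, the step behind the growth factor `n+1`) [cite: DLMF, 18.9.10]; N. J. Higham, *Accuracy and Stability of
Numerical Algorithms* (2nd ed., SIAM 2002), Ch. 3 (the standard rounding model that produces the hypothesis `‖e_j‖ ≤ ε`) — context only
[cite: Higham2002, Ch. 3].  The classical error analyses of Chebyshev recurrences (Clenshaw 1955, Elliott 1968, Oliver 1977) state the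
same second-kind growth factors; nothing here is specific to them.
-/

noncomputable section

open Finset Polynomial Polynomial.Chebyshev
open scoped BigOperators

namespace Summit.Ventures.YMGap.FlowData.ChebyshevRecurrenceStability

section Algebra

variable {R : Type*} [CommRing R] {M : Type*} [AddCommGroup M] [Module R M]

/-- `(2·A) x = 2 • A x` in `Module.End`. [cite: DLMF, 3.11(ii)] -/
theorem two_mul_apply (A : Module.End R M) (x : M) : (2 * A) x = (2 : R) • A x := by
  rw [two_mul, LinearMap.add_apply, two_smul]

/-- `aeval Y (2 X p − q) φ = 2 Y (aeval Y p φ) − aeval Y q φ`. [cite: DLMF, 3.11(ii)] -/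
theorem aeval_two_mul_X_mul_sub_apply (Y : Module.End R M) (p q : R[X]) (φ : M) :
    aeval Y (2 * X * p - q) φ = (2 : R) • Y (aeval Y p φ) - aeval Y q φ := by
  rw [map_sub, map_mul, map_mul, map_ofNat, aeval_X, LinearMap.sub_apply, mul_assoc, two_mul_apply,
    Module.End.mul_apply]

/-- The exact forward recurrence `t₀ = φ`, `t₁ = Y φ`, `t_{k+2} = 2 Y t_{k+1} − t_k` computes `t_k = T_k(Y) φ`.
[cite: DLMF, 3.11(ii)] -/
theorem eq_aeval_T_of_rec (Y : Module.End R M) {φ : M} {t : ℕ → M} (ht0 : t 0 = φ) (ht1 : t 1 = Y φ)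
    (ht : ∀ k, t (k + 2) = (2 : R) • Y (t (k + 1)) - t k) :
    ∀ k : ℕ, t k = aeval Y (Chebyshev.T R k) φ
  | 0 => by simp [ht0]
  | 1 => by simp [ht1]
  | (k + 2) => by
    rw [ht, eq_aeval_T_of_rec Y ht0 ht1 ht (k + 1), eq_aeval_T_of_rec Y ht0 ht1 ht k,
      ← aeval_two_mul_X_mul_sub_apply]
    congr 2
    have := Chebyshev.T_add_two R (k : ℤ)
    push_cast at this ⊢
    exact this.symm

/-- The growth-factor sum `D_k = Σ_{j<k} U_{k−1−j}(Y) e_{j+1}` obeys `D_{k+2} = 2 Y D_{k+1} − D_k + e_{k+2}`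
(`U_{m+2} = 2X U_{m+1} − U_m`, `U₀ = 1`, `U₁ = 2X`). [cite: DLMF, 3.11(ii)] -/
theorem sum_U_add_two (Y : Module.End R M) (e : ℕ → M) (k : ℕ) :
    ∑ j ∈ range (k + 2), aeval Y (Chebyshev.U R ((↑(k + 2) : ℤ) - 1 - j)) (e (j + 1)) =
      (2 : R) • Y (∑ j ∈ range (k + 1), aeval Y (Chebyshev.U R ((↑(k + 1) : ℤ) - 1 - j)) (e (j + 1))) -
        ∑ j ∈ range k, aeval Y (Chebyshev.U R ((k : ℤ) - 1 - j)) (e (j + 1)) + e (k + 2) := by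
  have hU0 : aeval Y (Chebyshev.U R ((↑(k + 2) : ℤ) - 1 - ↑(k + 1))) (e (k + 1 + 1)) = e (k + 2) := by
    have : ((↑(k + 2) : ℤ) - 1 - ↑(k + 1)) = 0 := by push_cast; ring
    rw [this, Chebyshev.U_zero, map_one, Module.End.one_apply]
  have hU1 : aeval Y (Chebyshev.U R ((↑(k + 2) : ℤ) - 1 - ↑k)) (e (k + 1)) =
      (2 : R) • Y (aeval Y (Chebyshev.U R ((↑(k + 1) : ℤ) - 1 - ↑k)) (e (k + 1))) := by
    have h1 : ((↑(k + 2) : ℤ) - 1 - ↑k) = 1 := by push_cast; ring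
    have h0 : ((↑(k + 1) : ℤ) - 1 - ↑k) = 0 := by push_cast; ring
    rw [h1, h0, Chebyshev.U_one, Chebyshev.U_zero, map_one, Module.End.one_apply, map_mul, map_ofNat, aeval_X,
      two_mul_apply]
  have hmain : ∀ j ∈ range k,
      aeval Y (Chebyshev.U R ((↑(k + 2) : ℤ) - 1 - ↑j)) (e (j + 1)) =
        (2 : R) • Y (aeval Y (Chebyshev.U R ((↑(k + 1) : ℤ) - 1 - ↑j)) (e (j + 1))) -
          aeval Y (Chebyshev.U R ((↑k : ℤ) - 1 - ↑j)) (e (j + 1)) := by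
    intro j _
    rw [← aeval_two_mul_X_mul_sub_apply]
    congr 2
    have := Chebyshev.U_add_two R ((k : ℤ) - 1 - j)
    have e1 : ((↑(k + 2) : ℤ) - 1 - ↑j) = ((k : ℤ) - 1 - j) + 2 := by push_cast; ring
    have e2 : ((↑(k + 1) : ℤ) - 1 - ↑j) = ((k : ℤ) - 1 - j) + 1 := by push_cast; ring
    rw [e1, e2, this]
  rw [sum_range_succ, sum_range_succ, hU0, hU1, sum_congr rfl hmain, sum_sub_distrib]
  rw [sum_range_succ, map_add, smul_add, map_sum, smul_sum]
  abel

/-- ★ **Error propagation through the Chebyshev recurrence.**  If `d₀ = 0`, `d₁ = e₁` and `d_{k+2} = 2 Y d_{k+1} − d_k + e_{k+2}`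
(the difference of the perturbed and the exact iterates), then `d_k = Σ_{j<k} U_{k−1−j}(Y) e_{j+1}` — second-kind Chebyshev polynomials
as growth factors. [cite: DLMF, 3.11(ii)] -/
theorem eq_sum_U_of_rec (Y : Module.End R M) {e d : ℕ → M} (hd0 : d 0 = 0) (hd1 : d 1 = e 1)
    (hd : ∀ k, d (k + 2) = (2 : R) • Y (d (k + 1)) - d k + e (k + 2)) :
    ∀ k : ℕ, d k = ∑ j ∈ range k, aeval Y (Chebyshev.U R ((k : ℤ) - 1 - j)) (e (j + 1))
  | 0 => by simp [hd0]
  | 1 => by simp [hd1]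
  | (k + 2) => by
    rw [hd, eq_sum_U_of_rec Y hd0 hd1 hd (k + 1), eq_sum_U_of_rec Y hd0 hd1 hd k, sum_U_add_two]

/-- ★ The same for a pair of sequences: exact `t` (`t₀ = φ`, `t₁ = Y φ`, `t_{k+2} = 2Y t_{k+1} − t_k`) and perturbed `s`
(`s₀ = φ`, `s₁ = Y φ + e₁`, `s_{k+2} = 2Y s_{k+1} − s_k + e_{k+2}`): `s_k − t_k = Σ_{j<k} U_{k−1−j}(Y) e_{j+1}`. [cite: DLMF, 3.11(ii)] -/
theorem sub_eq_sum_U_of_rec (Y : Module.End R M) {φ : M} {e t s : ℕ → M} (ht0 : t 0 = φ) (ht1 : t 1 = Y φ)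
    (ht : ∀ k, t (k + 2) = (2 : R) • Y (t (k + 1)) - t k) (hs0 : s 0 = φ) (hs1 : s 1 = Y φ + e 1)
    (hs : ∀ k, s (k + 2) = (2 : R) • Y (s (k + 1)) - s k + e (k + 2)) (k : ℕ) :
    s k - t k = ∑ j ∈ range k, aeval Y (Chebyshev.U R ((k : ℤ) - 1 - j)) (e (j + 1)) := by
  refine eq_sum_U_of_rec Y (d := fun k => s k - t k) (by simp [hs0, ht0]) (by simp [hs1, ht1]) ?_ k
  intro k
  simp only [hs, ht, map_sub, smul_sub]
  abel

/-- The exact Chebyshev sum is `p_K(Y) φ` with `p_K = Σ_{k≤K} c_k T_k`. [cite: DLMF, 3.11(ii)] -/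
theorem chebSum_eq_aeval (Y : Module.End R M) {φ : M} {t : ℕ → M} (ht0 : t 0 = φ) (ht1 : t 1 = Y φ)
    (ht : ∀ k, t (k + 2) = (2 : R) • Y (t (k + 1)) - t k) (c : ℕ → R) (K : ℕ) :
    ∑ k ∈ range (K + 1), c k • t k = aeval Y (∑ k ∈ range (K + 1), Polynomial.C (c k) * Chebyshev.T R k) φ := by
  rw [map_sum, LinearMap.coe_sum, Finset.sum_apply]
  refine sum_congr rfl fun k _ => ?_
  rw [map_mul, Polynomial.aeval_C, Module.End.mul_apply, Module.algebraMap_end_apply, eq_aeval_T_of_rec Y ht0 ht1 ht]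

end Algebra

section Normed

variable {E : Type*} [NormedAddCommGroup E] [NormedSpace ℝ E]

/-- If every `T_m(Y)` (`m ≥ 0`) is a contraction then `‖U_n(Y) v‖ ≤ (n+1)‖v‖` — the second-kind growth factor
(`U_{n+2} = 2 T_{n+2} + U_n`). [cite: DLMF, 18.9.10] -/
theorem norm_aeval_U_le (Y : Module.End ℝ E) (hT : ∀ (m : ℕ) (v : E), ‖aeval Y (Chebyshev.T ℝ m) v‖ ≤ ‖v‖) :
    ∀ (n : ℕ) (v : E), ‖aeval Y (Chebyshev.U ℝ n) v‖ ≤ (n + 1) * ‖v‖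
  | 0, v => by simp
  | 1, v => by
    have h := hT 1 v
    simp only [Nat.cast_one, Chebyshev.T_one, aeval_X] at h
    rw [Nat.cast_one, Chebyshev.U_one, map_mul, map_ofNat, aeval_X, two_mul_apply, norm_smul, Real.norm_eq_abs,
      abs_two]
    norm_num
    linarith
  | (n + 2), v => by
    have hrec := Chebyshev.U_eq_two_mul_T_add_U ℝ (n : ℤ)
    have hcast : ((↑(n + 2) : ℕ) : ℤ) = (n : ℤ) + 2 := by push_cast; ring
    rw [hcast, hrec, map_add, map_mul, map_ofNat, LinearMap.add_apply, two_mul_apply]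
    have h1 : ‖aeval Y (Chebyshev.T ℝ ((n : ℤ) + 2)) v‖ ≤ ‖v‖ := by exact_mod_cast hT (n + 2) v
    have h2 := norm_aeval_U_le Y hT n v
    calc ‖(2 : ℝ) • aeval Y (Chebyshev.T ℝ ((n : ℤ) + 2)) v + aeval Y (Chebyshev.U ℝ (n : ℤ)) v‖
        ≤ ‖(2 : ℝ) • aeval Y (Chebyshev.T ℝ ((n : ℤ) + 2)) v‖ + ‖aeval Y (Chebyshev.U ℝ (n : ℤ)) v‖ := norm_add_le _ _
      _ ≤ 2 * ‖v‖ + (n + 1) * ‖v‖ := by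
          rw [norm_smul, Real.norm_eq_abs, abs_two]
          exact add_le_add (by linarith) h2
      _ = ((↑(n + 2) : ℕ) + 1 : ℝ) * ‖v‖ := by push_cast; ring

/-- The growth-factor sum is bounded by `Σ_{j<k} (k − j)‖e_{j+1}‖`. [cite: DLMF, 3.11(ii)] -/
theorem norm_sum_U_le (Y : Module.End ℝ E) (hT : ∀ (m : ℕ) (v : E), ‖aeval Y (Chebyshev.T ℝ m) v‖ ≤ ‖v‖)
    (e : ℕ → E) (k : ℕ) :
    ‖∑ j ∈ range k, aeval Y (Chebyshev.U ℝ ((k : ℤ) - 1 - j)) (e (j + 1))‖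
      ≤ ∑ j ∈ range k, ((k : ℝ) - j) * ‖e (j + 1)‖ := by
  refine (norm_sum_le _ _).trans (sum_le_sum fun j hj => ?_)
  have hjk : j < k := mem_range.1 hj
  have hidx : ((k : ℤ) - 1 - j) = ((k - 1 - j : ℕ) : ℤ) := by omega
  rw [hidx]
  refine (norm_aeval_U_le Y hT (k - 1 - j) (e (j + 1))).trans (le_of_eq ?_)
  congr 1
  have : ((k - 1 - j : ℕ) : ℝ) = (k : ℝ) - 1 - j := by
    rw [Nat.cast_sub (by omega), Nat.cast_sub (by omega)]; push_cast; ring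
  rw [this]; ring

/-- ★ **Stability of the Chebyshev recurrence.**  If every `T_m(Y)` is a contraction, the rounding errors committed at the
steps propagate at most linearly: `‖s_k − t_k‖ ≤ Σ_{j<k} (k − j)‖e_{j+1}‖`. [cite: DLMF, 3.11(ii)] -/
theorem norm_sub_le_of_rec (Y : Module.End ℝ E) (hT : ∀ (m : ℕ) (v : E), ‖aeval Y (Chebyshev.T ℝ m) v‖ ≤ ‖v‖)
    {φ : E} {e t s : ℕ → E} (ht0 : t 0 = φ) (ht1 : t 1 = Y φ) (ht : ∀ k, t (k + 2) = (2 : ℝ) • Y (t (k + 1)) - t k)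
    (hs0 : s 0 = φ) (hs1 : s 1 = Y φ + e 1) (hs : ∀ k, s (k + 2) = (2 : ℝ) • Y (s (k + 1)) - s k + e (k + 2))
    (k : ℕ) : ‖s k - t k‖ ≤ ∑ j ∈ range k, ((k : ℝ) - j) * ‖e (j + 1)‖ := by
  rw [sub_eq_sum_U_of_rec Y ht0 ht1 ht hs0 hs1 hs]; exact norm_sum_U_le Y hT e k

/-- `Σ_{j<k} (k − j) = k(k+1)/2`. [cite: DLMF, 3.11(ii)] -/
theorem sum_range_cast_sub (k : ℕ) : ∑ j ∈ range k, ((k : ℝ) - j) = (k : ℝ) * (k + 1) / 2 := by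
  induction k with
  | zero => simp
  | succ k ih =>
    rw [sum_range_succ]
    have h : ∀ j ∈ range k, ((↑(k + 1) : ℕ) - (j : ℝ)) = ((k : ℝ) - j) + 1 := by intro j _; push_cast; ring
    rw [sum_congr rfl h, sum_add_distrib, ih, sum_const, card_range]
    push_cast; ring

/-- Uniform local errors `‖e_j‖ ≤ ε` give `‖s_k − t_k‖ ≤ ε · k(k+1)/2`. [cite: DLMF, 3.11(ii)] -/
theorem norm_sub_le_of_rec_of_uniform (Y : Module.End ℝ E)
    (hT : ∀ (m : ℕ) (v : E), ‖aeval Y (Chebyshev.T ℝ m) v‖ ≤ ‖v‖)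
    {φ : E} {e t s : ℕ → E} (ht0 : t 0 = φ) (ht1 : t 1 = Y φ) (ht : ∀ k, t (k + 2) = (2 : ℝ) • Y (t (k + 1)) - t k)
    (hs0 : s 0 = φ) (hs1 : s 1 = Y φ + e 1) (hs : ∀ k, s (k + 2) = (2 : ℝ) • Y (s (k + 1)) - s k + e (k + 2))
    {ε : ℝ} (he : ∀ j, ‖e j‖ ≤ ε) (k : ℕ) :
    ‖s k - t k‖ ≤ ε * ((k : ℝ) * (k + 1) / 2) := by
  refine (norm_sub_le_of_rec Y hT ht0 ht1 ht hs0 hs1 hs k).trans ?_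
  calc ∑ j ∈ range k, ((k : ℝ) - j) * ‖e (j + 1)‖ ≤ ∑ j ∈ range k, ((k : ℝ) - j) * ε := by
        refine sum_le_sum fun j hj => mul_le_mul_of_nonneg_left (he _) ?_
        have : j < k := mem_range.1 hj
        have : (j : ℝ) < k := by exact_mod_cast this
        linarith
    _ = ε * ((k : ℝ) * (k + 1) / 2) := by rw [← sum_mul, sum_range_cast_sub]; ring

/-- ★ **The «second-kind growth factor» term of the x2r rounding budget.**  For the Chebyshev sum
`ĝ = Σ_{k≤K} c_k s_k` computed from the perturbed iterates versus `g_K = Σ_{k≤K} c_k t_k`: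
`‖ĝ − g_K‖ ≤ ε · Σ_{k≤K} |c_k| · k(k+1)/2`. [cite: DLMF, 3.11(ii)] -/
theorem norm_chebSum_sub_le (Y : Module.End ℝ E)
    (hT : ∀ (m : ℕ) (v : E), ‖aeval Y (Chebyshev.T ℝ m) v‖ ≤ ‖v‖)
    {φ : E} {e t s : ℕ → E} (ht0 : t 0 = φ) (ht1 : t 1 = Y φ) (ht : ∀ k, t (k + 2) = (2 : ℝ) • Y (t (k + 1)) - t k)
    (hs0 : s 0 = φ) (hs1 : s 1 = Y φ + e 1) (hs : ∀ k, s (k + 2) = (2 : ℝ) • Y (s (k + 1)) - s k + e (k + 2))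
    {ε : ℝ} (he : ∀ j, ‖e j‖ ≤ ε) (c : ℕ → ℝ) (K : ℕ) :
    ‖∑ k ∈ range (K + 1), c k • s k - ∑ k ∈ range (K + 1), c k • t k‖
      ≤ ε * ∑ k ∈ range (K + 1), |c k| * ((k : ℝ) * (k + 1) / 2) := by
  rw [← sum_sub_distrib, mul_sum]
  refine (norm_sum_le _ _).trans (sum_le_sum fun k _ => ?_)
  rw [← smul_sub, norm_smul, Real.norm_eq_abs]
  calc |c k| * ‖s k - t k‖ ≤ |c k| * (ε * ((k : ℝ) * (k + 1) / 2)) :=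
        mul_le_mul_of_nonneg_left (norm_sub_le_of_rec_of_uniform Y hT ht0 ht1 ht hs0 hs1 hs he k) (abs_nonneg _)
    _ = ε * (|c k| * ((k : ℝ) * (k + 1) / 2)) := by ring

end Normed

section Symmetric

variable {E : Type*} [NormedAddCommGroup E] [InnerProductSpace ℝ E] [FiniteDimensional ℝ E]

/-- Functional calculus bound for a symmetric contraction on a finite-dimensional real inner-product space:
if `|p(x)| ≤ B` on `[−1, 1]` then `‖p(Y) v‖ ≤ B‖v‖` (eigenbasis expansion; eigenvalues of a symmetric contraction lie
in `[−1,1]`). [cite: DLMF, 3.11(ii)] -/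
theorem norm_aeval_le_of_isSymmetric {Y : E →ₗ[ℝ] E} (hY : Y.IsSymmetric) (hc : ∀ v, ‖Y v‖ ≤ ‖v‖)
    (p : ℝ[X]) {B : ℝ} (hB0 : 0 ≤ B) (hB : ∀ x : ℝ, |x| ≤ 1 → |p.eval x| ≤ B) (v : E) :
    ‖aeval Y p v‖ ≤ B * ‖v‖ := by
  set n := Module.finrank ℝ E
  have hn : Module.finrank ℝ E = n := rfl
  set b := hY.eigenvectorBasis hn with hb
  have key : ∀ i, ∃ μ : ℝ, |μ| ≤ 1 ∧ aeval Y p (b i) = p.eval μ • b i := by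
    intro i
    refine ⟨_, ?_, Module.End.aeval_apply_of_hasEigenvector (hY.hasEigenvector_eigenvectorBasis hn i)⟩
    have h1 := hY.apply_eigenvectorBasis hn i
    have h2 := hc (b i)
    rw [hb] at h2
    rw [h1, norm_smul, b.orthonormal.1 i, mul_one, Real.norm_eq_abs] at h2
    exact h2
  choose μ hμ hp using key
  have hv : aeval Y p v = ∑ i, (b.repr v i * p.eval (μ i)) • b i := by
    conv_lhs => rw [← b.sum_repr v]
    rw [map_sum]
    refine sum_congr rfl fun i _ => ?_
    rw [map_smul, hp, smul_smul]
  have hsq : ‖aeval Y p v‖ ^ 2 = ∑ i, (b.repr v i * p.eval (μ i)) ^ 2 := by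
    rw [hv, ← real_inner_self_eq_norm_sq, b.orthonormal.inner_sum]
    refine sum_congr rfl fun i _ => ?_
    simp [pow_two]
  have hv2 : ‖v‖ ^ 2 = ∑ i, (b.repr v i) ^ 2 := by
    rw [← b.sum_sq_inner_right v]
    refine sum_congr rfl fun i _ => ?_
    rw [b.repr_apply_apply]
  have hle : ‖aeval Y p v‖ ^ 2 ≤ (B * ‖v‖) ^ 2 := by
    rw [hsq, mul_pow, hv2, mul_sum]
    refine sum_le_sum fun i _ => ?_
    rw [mul_pow]
    have hpi : (p.eval (μ i)) ^ 2 ≤ B ^ 2 := by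
      rw [← sq_abs]; exact pow_le_pow_left₀ (abs_nonneg _) (hB _ (hμ i)) 2
    calc (b.repr v i) ^ 2 * (p.eval (μ i)) ^ 2 ≤ (b.repr v i) ^ 2 * B ^ 2 :=
          mul_le_mul_of_nonneg_left hpi (sq_nonneg _)
      _ = B ^ 2 * (b.repr v i) ^ 2 := mul_comm _ _
  have h := Real.sqrt_le_sqrt hle
  rwa [Real.sqrt_sq (norm_nonneg _), Real.sqrt_sq (mul_nonneg hB0 (norm_nonneg _))] at h

/-- The contraction hypothesis of `norm_aeval_U_le` DISCHARGED for a symmetric contraction: `‖T_m(Y) v‖ ≤ ‖v‖`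
(`|T_m(x)| ≤ 1` on `[−1, 1]`, Mathlib `abs_eval_T_real_le_one`). [cite: DLMF, 3.11(ii)] -/
theorem norm_aeval_T_le_of_isSymmetric {Y : E →ₗ[ℝ] E} (hY : Y.IsSymmetric) (hc : ∀ v, ‖Y v‖ ≤ ‖v‖)
    (m : ℤ) (v : E) : ‖aeval Y (Chebyshev.T ℝ m) v‖ ≤ ‖v‖ := by
  simpa using norm_aeval_le_of_isSymmetric hY hc (Chebyshev.T ℝ m) zero_le_one
    (fun x hx => abs_eval_T_real_le_one m hx) v

/-- ★ **Assembled statement for the x2r kernel's setting.**  `Y` symmetric with `‖Y v‖ ≤ ‖v‖` on a finite-dimensional real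
inner-product space (the box-restricted plaquette variable `s = 1 − 2y`), exact iterates `t`, perturbed iterates `s` with local
step errors `‖e_j‖ ≤ ε`: `‖Σ_{k≤K} c_k s_k − Σ_{k≤K} c_k t_k‖ ≤ ε · Σ_{k≤K} |c_k| · k(k+1)/2`. [cite: DLMF, 3.11(ii)] -/
theorem norm_chebSum_sub_le_of_isSymmetric {Y : E →ₗ[ℝ] E} (hY : Y.IsSymmetric) (hc : ∀ v, ‖Y v‖ ≤ ‖v‖)
    {φ : E} {e t s : ℕ → E} (ht0 : t 0 = φ) (ht1 : t 1 = Y φ) (ht : ∀ k, t (k + 2) = (2 : ℝ) • Y (t (k + 1)) - t k)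
    (hs0 : s 0 = φ) (hs1 : s 1 = Y φ + e 1) (hs : ∀ k, s (k + 2) = (2 : ℝ) • Y (s (k + 1)) - s k + e (k + 2))
    {ε : ℝ} (he : ∀ j, ‖e j‖ ≤ ε) (c : ℕ → ℝ) (K : ℕ) :
    ‖∑ k ∈ range (K + 1), c k • s k - ∑ k ∈ range (K + 1), c k • t k‖
      ≤ ε * ∑ k ∈ range (K + 1), |c k| * ((k : ℝ) * (k + 1) / 2) :=
  norm_chebSum_sub_le Y (fun m v => norm_aeval_T_le_of_isSymmetric hY hc m v) ht0 ht1 ht hs0 hs1 hs he c K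

end Symmetric

end Summit.Ventures.YMGap.FlowData.ChebyshevRecurrenceStability
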